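import Summits.AtomisticToContinuum.Crystallization.Theorems.ExcessDecayLiouvilleHcpLiouvilleBlowdownGalerkinEnergy

/-!
# `ExcessDecayLiouville.HcpLiouville` (stmt-AtomisticToContinuum-9332), line `Sketch` v4: the Galerkin limit, I

Helper file for sub-goal `blowdown_greenSolve` (H2 of stub `stub_green`) of crux stmt-AtomisticToContinuum-9332
(`Summit.AtomisticToContinuum.Crystallization.Theses.ExcessDecayLiouville.HcpLiouville`), line `Sketch`, skeleton
v4.  For an admissible right-hand side `f` (`|Σ'⟪f, w⟫| ≤ N √(nnForm w)`) and a family `U V` of Galerkin solutions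
indexed by the finite sets `V` of sites (directed by inclusion), the energies `E_V` increase to their supremum, so by
the monotone-energy inequality `κ · nnForm (u_W − u_V) ≤ E_W − E_V` and a CAPACITY inequality
`‖w p‖² ≤ C · nnForm w` (hypothesis `hcap`; sub-goal `blowdown_capacity`) the net `V ↦ U V p` is Cauchy at every
site (`cauchySeq_galerkin`) and converges (`exists_tendsto_galerkin`).  For any pointwise limit `G` we derive the
pointwise bound `‖G p‖ ≤ √C · N/κ` and the energy bound: the nearest-neighbour pair family of `G` is summable with
`nnForm G ≤ (N/κ)²` (Fatou on finite partial sums).  All `[folklore]`; a `--supports` helper, nothing here closes an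
item.
-/

noncomputable section

namespace Summit.AtomisticToContinuum.Crystallization.Theorems.ExcessDecayLiouville

open scoped BigOperators Topology Classical InnerProductSpace RealInnerProductSpace
open Filter
open Literature.MathematicalPhysics.StatisticalMechanics
open Summit.AtomisticToContinuum.Crystallization.Theses.ExcessDecayLiouville
open Summit.AtomisticToContinuum.Crystallization.Theorems.PhononStabilityNegative

section

variable {t : Fin 2 → EuclideanSpace ℝ (Fin 3)} {A : EuclideanSpace ℝ (Fin 3) →L[ℝ] EuclideanSpace ℝ (Fin 3)}
  {κ : ℝ} {f : EuclideanSpace ℝ (Fin 3) → EuclideanSpace ℝ (Fin 3)} {N : ℝ}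
  {U : Finset (Sites₀ t A) → EuclideanSpace ℝ (Fin 3) → EuclideanSpace ℝ (Fin 3)} {C : ℝ}

/-! ## The nearest-neighbour pair family of a finitely supported field -/

/-- For a finitely supported field the nearest-neighbour pair family is summable on `S × S` and sums to `nnForm`.
[folklore] -/
theorem summable_nnPair_of_finite (hA : Adm₀ A) (hI : Inner₀ t A)
    {u : EuclideanSpace ℝ (Fin 3) → EuclideanSpace ℝ (Fin 3)} (hu : (Function.support u).Finite) :
    Summable (fun pq : Sites₀ t A × Sites₀ t A =>
      if dist (pq.1 : EuclideanSpace ℝ (Fin 3)) pq.2 ≤ 11 / 10 then ‖u pq.1 - u pq.2‖ ^ 2 else 0) ∧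
    nnForm t A u = ∑' pq : Sites₀ t A × Sites₀ t A,
      (if dist (pq.1 : EuclideanSpace ℝ (Fin 3)) pq.2 ≤ 11 / 10 then ‖u pq.1 - u pq.2‖ ^ 2 else 0) := by
  have hnn : 0 ≤ fun pq : Sites₀ t A × Sites₀ t A =>
      (if dist (pq.1 : EuclideanSpace ℝ (Fin 3)) pq.2 ≤ 11 / 10 then ‖u pq.1 - u pq.2‖ ^ 2 else 0) :=
    fun pq => by simp only [Pi.zero_apply]; split_ifs <;> positivity
  have hs : Summable (fun pq : Sites₀ t A × Sites₀ t A =>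
      if dist (pq.1 : EuclideanSpace ℝ (Fin 3)) pq.2 ≤ 11 / 10 then ‖u pq.1 - u pq.2‖ ^ 2 else 0) := by
    rw [summable_prod_of_nonneg hnn]
    exact ⟨fun p => summable_nnRow hA hI u p, summable_nnRows hA hI hu⟩
  refine ⟨hs, ?_⟩
  rw [hs.tsum_prod' (fun p => summable_nnRow hA hI u p)]
  rfl

/-- Finite partial sums of the nearest-neighbour pair family are bounded by `nnForm` (finitely supported field).
[folklore] -/
theorem sum_nnPair_le_nnForm (hA : Adm₀ A) (hI : Inner₀ t A)
    {u : EuclideanSpace ℝ (Fin 3) → EuclideanSpace ℝ (Fin 3)} (hu : (Function.support u).Finite)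
    (T : Finset (Sites₀ t A × Sites₀ t A)) :
    ∑ pq ∈ T, (if dist (pq.1 : EuclideanSpace ℝ (Fin 3)) pq.2 ≤ 11 / 10 then ‖u pq.1 - u pq.2‖ ^ 2 else 0) ≤
      nnForm t A u := by
  obtain ⟨hs, heq⟩ := summable_nnPair_of_finite hA hI hu
  rw [heq]
  exact hs.sum_le_tsum T fun pq _ => by split_ifs <;> positivity

/-! ## Energies of the Galerkin family: monotone, bounded, convergent -/

/-- The energies `E_V = Σ'⟪f, U V⟫` of a Galerkin family form a monotone net bounded by `N²/κ`, hence converge to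
their supremum. [folklore] -/
theorem tendsto_energy (hA : Adm₀ A) (hI : Inner₀ t A) (hκ : 0 < κ) (hPS : Blowdown.PSIneq κ t A) (hN : 0 ≤ N)
    (hf : ∀ w : EuclideanSpace ℝ (Fin 3) → EuclideanSpace ℝ (Fin 3), (Function.support w).Finite →
      Function.support w ⊆ Sites₀ t A → |∑' p : Sites₀ t A, ⟪f p, w p⟫| ≤ N * Real.sqrt (nnForm t A w))
    (hU : ∀ V : Finset (Sites₀ t A), Function.support (U V) ⊆ Subtype.val '' (V : Set (Sites₀ t A)) ∧
      ∀ p : Sites₀ t A, p ∈ V →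
        ∑' q : Sites₀ t A, forceConst ((p : EuclideanSpace ℝ (Fin 3)) - q) (U V p - U V q) = f p) :
    Monotone (fun V : Finset (Sites₀ t A) => ∑' p : Sites₀ t A, ⟪f p, U V p⟫) ∧
    (∀ V : Finset (Sites₀ t A), ∑' p : Sites₀ t A, ⟪f p, U V p⟫ ≤
      ⨆ W : Finset (Sites₀ t A), ∑' p : Sites₀ t A, ⟪f p, U W p⟫) ∧
    Tendsto (fun V : Finset (Sites₀ t A) => ∑' p : Sites₀ t A, ⟪f p, U V p⟫) atTop
      (𝓝 (⨆ W : Finset (Sites₀ t A), ∑' p : Sites₀ t A, ⟪f p, U W p⟫)) := by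
  have hmono : Monotone (fun V : Finset (Sites₀ t A) => ∑' p : Sites₀ t A, ⟪f p, U V p⟫) :=
    fun V W hVW => energy_mono hA hI hκ hPS hVW (hU V).1 (hU V).2 (hU W).1 (hU W).2
  have hbdd : BddAbove (Set.range fun V : Finset (Sites₀ t A) => ∑' p : Sites₀ t A, ⟪f p, U V p⟫) := by
    refine ⟨N ^ 2 / κ, ?_⟩
    rintro _ ⟨V, rfl⟩
    exact (energy_bounds hA hI hκ hPS hN hf (hU V).1 (hU V).2).2.2.2
  exact ⟨hmono, fun V => le_ciSup hbdd V, tendsto_atTop_ciSup hmono hbdd⟩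

/-- **Nested levels are close when the energies are close**: for `V ⊆ W` and a site `p`,
`‖U W p − U V p‖² ≤ C/κ · (E_W − E_V)` (capacity + monotone energies). [folklore] -/
theorem norm_sub_sq_le_energy_sub (hA : Adm₀ A) (hI : Inner₀ t A) (hκ : 0 < κ) (hPS : Blowdown.PSIneq κ t A)
    (hU : ∀ V : Finset (Sites₀ t A), Function.support (U V) ⊆ Subtype.val '' (V : Set (Sites₀ t A)) ∧
      ∀ p : Sites₀ t A, p ∈ V →
        ∑' q : Sites₀ t A, forceConst ((p : EuclideanSpace ℝ (Fin 3)) - q) (U V p - U V q) = f p)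
    (hC : 0 ≤ C)
    (hcap : ∀ w : EuclideanSpace ℝ (Fin 3) → EuclideanSpace ℝ (Fin 3), (Function.support w).Finite →
      Function.support w ⊆ Sites₀ t A → ∀ p ∈ Sites₀ t A, ‖w p‖ ^ 2 ≤ C * nnForm t A w)
    {V W : Finset (Sites₀ t A)} (hVW : V ⊆ W) (p : Sites₀ t A) :
    ‖U W p - U V p‖ ^ 2 ≤ C / κ * (∑' q : Sites₀ t A, ⟪f q, U W q⟫ - ∑' q : Sites₀ t A, ⟪f q, U V q⟫) := by
  have hmon := mul_nnForm_sub_le_energy_sub hA hI hPS hVW (hU V).1 (hU V).2 (hU W).1 (hU W).2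
  have hd : Function.support (fun x => U W x - U V x) ⊆ Subtype.val '' (W : Set (Sites₀ t A)) := by
    intro x hx
    by_contra hx'
    have h1 : U W x = 0 := by
      by_contra h
      exact hx' ((hU W).1 h)
    have h2 : U V x = 0 := by
      by_contra h
      exact hx' ((Set.image_mono (Finset.coe_subset.2 hVW)) ((hU V).1 h))
    exact hx (by simp [h1, h2])
  have hc := hcap (fun x => U W x - U V x) (finite_support_of_subset_image hd)
    (support_subset_sites_of_subset_image hd) p p.2
  have hnn : nnForm t A (fun x => U W x - U V x) ≤
      (∑' q : Sites₀ t A, ⟪f q, U W q⟫ - ∑' q : Sites₀ t A, ⟪f q, U V q⟫) / κ := by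
    rw [le_div_iff₀ hκ, mul_comm]
    exact hmon
  calc ‖U W p - U V p‖ ^ 2 ≤ C * nnForm t A (fun x => U W x - U V x) := hc
    _ ≤ C * ((∑' q : Sites₀ t A, ⟪f q, U W q⟫ - ∑' q : Sites₀ t A, ⟪f q, U V q⟫) / κ) :=
        mul_le_mul_of_nonneg_left hnn hC
    _ = C / κ * (∑' q : Sites₀ t A, ⟪f q, U W q⟫ - ∑' q : Sites₀ t A, ⟪f q, U V q⟫) := by ring

/-- **The Galerkin net is Cauchy at every site.** [folklore] -/
theorem cauchySeq_galerkin (hA : Adm₀ A) (hI : Inner₀ t A) (hκ : 0 < κ) (hPS : Blowdown.PSIneq κ t A) (hN : 0 ≤ N)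
    (hf : ∀ w : EuclideanSpace ℝ (Fin 3) → EuclideanSpace ℝ (Fin 3), (Function.support w).Finite →
      Function.support w ⊆ Sites₀ t A → |∑' p : Sites₀ t A, ⟪f p, w p⟫| ≤ N * Real.sqrt (nnForm t A w))
    (hU : ∀ V : Finset (Sites₀ t A), Function.support (U V) ⊆ Subtype.val '' (V : Set (Sites₀ t A)) ∧
      ∀ p : Sites₀ t A, p ∈ V →
        ∑' q : Sites₀ t A, forceConst ((p : EuclideanSpace ℝ (Fin 3)) - q) (U V p - U V q) = f p)
    (hC : 0 ≤ C)
    (hcap : ∀ w : EuclideanSpace ℝ (Fin 3) → EuclideanSpace ℝ (Fin 3), (Function.support w).Finite →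
      Function.support w ⊆ Sites₀ t A → ∀ p ∈ Sites₀ t A, ‖w p‖ ^ 2 ≤ C * nnForm t A w)
    (p : Sites₀ t A) : CauchySeq (fun V : Finset (Sites₀ t A) => U V p) := by
  obtain ⟨_, hle, hE⟩ := tendsto_energy hA hI hκ hPS hN hf hU
  set L := ⨆ W : Finset (Sites₀ t A), ∑' q : Sites₀ t A, ⟪f q, U W q⟫ with hL
  rw [Metric.cauchySeq_iff']
  intro ε hε
  have hδ : 0 < ε ^ 2 * κ / (C + 1) := by positivity
  obtain ⟨V₀, hV₀⟩ := (Metric.tendsto_atTop.1 hE) (ε ^ 2 * κ / (C + 1)) hδ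
  refine ⟨V₀, fun V hV => ?_⟩
  have h1 := norm_sub_sq_le_energy_sub hA hI hκ hPS hU hC hcap hV p
  have h2 : ∑' q : Sites₀ t A, ⟪f q, U V q⟫ - ∑' q : Sites₀ t A, ⟪f q, U V₀ q⟫ < ε ^ 2 * κ / (C + 1) := by
    have hV0 := hV₀ V₀ le_rfl
    rw [Real.dist_eq, abs_sub_lt_iff] at hV0
    have hVle := hle V
    linarith [hV0.2]
  have h3 : ‖U V p - U V₀ p‖ ^ 2 < ε ^ 2 := by
    calc ‖U V p - U V₀ p‖ ^ 2 ≤ C / κ * (∑' q : Sites₀ t A, ⟪f q, U V q⟫ - ∑' q : Sites₀ t A, ⟪f q, U V₀ q⟫) := h1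
      _ ≤ C / κ * (ε ^ 2 * κ / (C + 1)) := mul_le_mul_of_nonneg_left h2.le (by positivity)
      _ = ε ^ 2 * (C / (C + 1)) := by field_simp
      _ < ε ^ 2 * 1 := by
          refine mul_lt_mul_of_pos_left ?_ (by positivity)
          rw [div_lt_one (by positivity)]
          linarith
      _ = ε ^ 2 := mul_one _
  rw [dist_eq_norm]
  exact (abs_lt_of_sq_lt_sq' h3 hε.le).2

/-- **The Galerkin net converges at every site.** [folklore] -/
theorem exists_tendsto_galerkin (hA : Adm₀ A) (hI : Inner₀ t A) (hκ : 0 < κ) (hPS : Blowdown.PSIneq κ t A)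
    (hN : 0 ≤ N)
    (hf : ∀ w : EuclideanSpace ℝ (Fin 3) → EuclideanSpace ℝ (Fin 3), (Function.support w).Finite →
      Function.support w ⊆ Sites₀ t A → |∑' p : Sites₀ t A, ⟪f p, w p⟫| ≤ N * Real.sqrt (nnForm t A w))
    (hU : ∀ V : Finset (Sites₀ t A), Function.support (U V) ⊆ Subtype.val '' (V : Set (Sites₀ t A)) ∧
      ∀ p : Sites₀ t A, p ∈ V →
        ∑' q : Sites₀ t A, forceConst ((p : EuclideanSpace ℝ (Fin 3)) - q) (U V p - U V q) = f p)
    (hC : 0 ≤ C)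
    (hcap : ∀ w : EuclideanSpace ℝ (Fin 3) → EuclideanSpace ℝ (Fin 3), (Function.support w).Finite →
      Function.support w ⊆ Sites₀ t A → ∀ p ∈ Sites₀ t A, ‖w p‖ ^ 2 ≤ C * nnForm t A w)
    (p : Sites₀ t A) : ∃ g : EuclideanSpace ℝ (Fin 3), Tendsto (fun V : Finset (Sites₀ t A) => U V p) atTop (𝓝 g) :=
  cauchySeq_tendsto_of_complete (cauchySeq_galerkin hA hI hκ hPS hN hf hU hC hcap p)

/-! ## Bounds of a pointwise limit: clause (ii) and clause (iii) -/

/-- **Pointwise bound at the finite level**: `‖U V p‖ ≤ √C · (N/κ)` (capacity + energy bound). [folklore] -/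
theorem norm_galerkin_le (hA : Adm₀ A) (hI : Inner₀ t A) (hκ : 0 < κ) (hPS : Blowdown.PSIneq κ t A) (hN : 0 ≤ N)
    (hf : ∀ w : EuclideanSpace ℝ (Fin 3) → EuclideanSpace ℝ (Fin 3), (Function.support w).Finite →
      Function.support w ⊆ Sites₀ t A → |∑' p : Sites₀ t A, ⟪f p, w p⟫| ≤ N * Real.sqrt (nnForm t A w))
    {V : Finset (Sites₀ t A)} {u : EuclideanSpace ℝ (Fin 3) → EuclideanSpace ℝ (Fin 3)}
    (hu : Function.support u ⊆ Subtype.val '' (V : Set (Sites₀ t A)))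
    (hru : ∀ p : Sites₀ t A, p ∈ V →
      ∑' q : Sites₀ t A, forceConst ((p : EuclideanSpace ℝ (Fin 3)) - q) (u p - u q) = f p)
    (hC : 0 ≤ C)
    (hcap : ∀ w : EuclideanSpace ℝ (Fin 3) → EuclideanSpace ℝ (Fin 3), (Function.support w).Finite →
      Function.support w ⊆ Sites₀ t A → ∀ p ∈ Sites₀ t A, ‖w p‖ ^ 2 ≤ C * nnForm t A w)
    (p : Sites₀ t A) : ‖u p‖ ≤ Real.sqrt C * (N / κ) := by
  have hb := (energy_bounds hA hI hκ hPS hN hf hu hru).2.1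
  have hc := hcap u (finite_support_of_subset_image hu) (support_subset_sites_of_subset_image hu) p p.2
  have h2 : ‖u p‖ ^ 2 ≤ (Real.sqrt C * (N / κ)) ^ 2 := by
    calc ‖u p‖ ^ 2 ≤ C * nnForm t A u := hc
      _ ≤ C * (N / κ) ^ 2 := mul_le_mul_of_nonneg_left hb hC
      _ = (Real.sqrt C * (N / κ)) ^ 2 := by rw [mul_pow, Real.sq_sqrt hC]
  exact (abs_le_of_sq_le_sq' h2 (by positivity)).2

/-- **Pointwise bound of the limit** (clause (ii)): `‖G p‖ ≤ √C · (N/κ)`. [folklore] -/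
theorem norm_lim_le (hA : Adm₀ A) (hI : Inner₀ t A) (hκ : 0 < κ) (hPS : Blowdown.PSIneq κ t A) (hN : 0 ≤ N)
    (hf : ∀ w : EuclideanSpace ℝ (Fin 3) → EuclideanSpace ℝ (Fin 3), (Function.support w).Finite →
      Function.support w ⊆ Sites₀ t A → |∑' p : Sites₀ t A, ⟪f p, w p⟫| ≤ N * Real.sqrt (nnForm t A w))
    (hU : ∀ V : Finset (Sites₀ t A), Function.support (U V) ⊆ Subtype.val '' (V : Set (Sites₀ t A)) ∧
      ∀ p : Sites₀ t A, p ∈ V →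
        ∑' q : Sites₀ t A, forceConst ((p : EuclideanSpace ℝ (Fin 3)) - q) (U V p - U V q) = f p)
    (hC : 0 ≤ C)
    (hcap : ∀ w : EuclideanSpace ℝ (Fin 3) → EuclideanSpace ℝ (Fin 3), (Function.support w).Finite →
      Function.support w ⊆ Sites₀ t A → ∀ p ∈ Sites₀ t A, ‖w p‖ ^ 2 ≤ C * nnForm t A w)
    {G : EuclideanSpace ℝ (Fin 3) → EuclideanSpace ℝ (Fin 3)}
    (hG : ∀ p : Sites₀ t A, Tendsto (fun V : Finset (Sites₀ t A) => U V p) atTop (𝓝 (G p))) (p : Sites₀ t A) :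
    ‖G p‖ ≤ Real.sqrt C * (N / κ) :=
  le_of_tendsto (tendsto_norm.comp (hG p))
    (Eventually.of_forall fun V => norm_galerkin_le hA hI hκ hPS hN hf (hU V).1 (hU V).2 hC hcap p)

/-- **Energy bound of the limit** (clause (iii)): the nearest-neighbour pair family of `G` is summable with sum
`≤ (N/κ)²`, and `nnForm G ≤ (N/κ)²`. [folklore] -/
theorem nnPair_lim (hA : Adm₀ A) (hI : Inner₀ t A) (hκ : 0 < κ) (hPS : Blowdown.PSIneq κ t A) (hN : 0 ≤ N)
    (hf : ∀ w : EuclideanSpace ℝ (Fin 3) → EuclideanSpace ℝ (Fin 3), (Function.support w).Finite →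
      Function.support w ⊆ Sites₀ t A → |∑' p : Sites₀ t A, ⟪f p, w p⟫| ≤ N * Real.sqrt (nnForm t A w))
    (hU : ∀ V : Finset (Sites₀ t A), Function.support (U V) ⊆ Subtype.val '' (V : Set (Sites₀ t A)) ∧
      ∀ p : Sites₀ t A, p ∈ V →
        ∑' q : Sites₀ t A, forceConst ((p : EuclideanSpace ℝ (Fin 3)) - q) (U V p - U V q) = f p)
    {G : EuclideanSpace ℝ (Fin 3) → EuclideanSpace ℝ (Fin 3)}
    (hG : ∀ p : Sites₀ t A, Tendsto (fun V : Finset (Sites₀ t A) => U V p) atTop (𝓝 (G p))) :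
    Summable (fun pq : Sites₀ t A × Sites₀ t A =>
      if dist (pq.1 : EuclideanSpace ℝ (Fin 3)) pq.2 ≤ 11 / 10 then ‖G pq.1 - G pq.2‖ ^ 2 else 0) ∧
    ∑' pq : Sites₀ t A × Sites₀ t A,
      (if dist (pq.1 : EuclideanSpace ℝ (Fin 3)) pq.2 ≤ 11 / 10 then ‖G pq.1 - G pq.2‖ ^ 2 else 0) ≤ (N / κ) ^ 2 ∧
    nnForm t A G ≤ (N / κ) ^ 2 := by
  have hnn : 0 ≤ fun pq : Sites₀ t A × Sites₀ t A =>
      (if dist (pq.1 : EuclideanSpace ℝ (Fin 3)) pq.2 ≤ 11 / 10 then ‖G pq.1 - G pq.2‖ ^ 2 else 0) :=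
    fun pq => by simp only [Pi.zero_apply]; split_ifs <;> positivity
  -- termwise convergence of the pair family
  have hpt : ∀ pq : Sites₀ t A × Sites₀ t A, Tendsto (fun V : Finset (Sites₀ t A) =>
      (if dist (pq.1 : EuclideanSpace ℝ (Fin 3)) pq.2 ≤ 11 / 10 then ‖U V pq.1 - U V pq.2‖ ^ 2 else 0)) atTop
      (𝓝 (if dist (pq.1 : EuclideanSpace ℝ (Fin 3)) pq.2 ≤ 11 / 10 then ‖G pq.1 - G pq.2‖ ^ 2 else 0)) := by
    intro pq
    split_ifs
    · exact (((hG pq.1).sub (hG pq.2)).norm).pow 2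
    · exact tendsto_const_nhds
  -- finite partial sums are bounded
  have hT : ∀ T : Finset (Sites₀ t A × Sites₀ t A),
      ∑ pq ∈ T, (if dist (pq.1 : EuclideanSpace ℝ (Fin 3)) pq.2 ≤ 11 / 10 then ‖G pq.1 - G pq.2‖ ^ 2 else 0) ≤
        (N / κ) ^ 2 := by
    intro T
    refine le_of_tendsto (tendsto_finsetSum T fun pq _ => hpt pq) (Eventually.of_forall fun V => ?_)
    exact (sum_nnPair_le_nnForm hA hI (finite_support_of_subset_image (hU V).1) T).trans
      (energy_bounds hA hI hκ hPS hN hf (hU V).1 (hU V).2).2.1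
  have hs : Summable (fun pq : Sites₀ t A × Sites₀ t A =>
      if dist (pq.1 : EuclideanSpace ℝ (Fin 3)) pq.2 ≤ 11 / 10 then ‖G pq.1 - G pq.2‖ ^ 2 else 0) :=
    summable_of_sum_le hnn hT
  refine ⟨hs, hs.tsum_le_of_sum_le hT, ?_⟩
  unfold nnForm
  rw [← hs.tsum_prod' (fun p => summable_nnRow hA hI G p)]
  exact hs.tsum_le_of_sum_le hT

end

/-- Registered helper of sub-goal `blowdown_greenSolve` (H2 of stub `stub_green`, crux stmt-AtomisticToContinuum-9332,
line `Sketch` v4): under a capacity inequality, the Galerkin net of an admissible right-hand side converges at every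
site. [folklore] -/
theorem blowdown_galerkinLimit : ∀ (κ : ℝ) (t : Fin 2 → (EuclideanSpace ℝ (Fin 3))) (A : (EuclideanSpace ℝ (Fin 3)) →L[ℝ] (EuclideanSpace ℝ (Fin 3))), 0 < κ → Adm₀ A → Inner₀ t A → Blowdown.PSIneq κ t A → ∀ (f : (EuclideanSpace ℝ (Fin 3)) → (EuclideanSpace ℝ (Fin 3))) (N : ℝ) (U : Finset (Sites₀ t A) → (EuclideanSpace ℝ (Fin 3)) → (EuclideanSpace ℝ (Fin 3))) (C : ℝ), 0 ≤ N → (∀ w : (EuclideanSpace ℝ (Fin 3)) → (EuclideanSpace ℝ (Fin 3)), (Function.support w).Finite → Function.support w ⊆ Sites₀ t A → |∑' p : Sites₀ t A, ⟪f p, w p⟫_ℝ| ≤ N * Real.sqrt (nnForm t A w)) → (∀ V : Finset (Sites₀ t A), Function.support (U V) ⊆ Subtype.val '' (V : Set (Sites₀ t A)) ∧ ∀ p : Sites₀ t A, p ∈ V → ∑' q : Sites₀ t A, forceConst ((p : (EuclideanSpace ℝ (Fin 3))) - q) (U V p - U V q) = f p) → 0 ≤ C → (∀ w : (EuclideanSpace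 ℝ (Fin 3)) → (EuclideanSpace ℝ (Fin 3)), (Function.support w).Finite → Function.support w ⊆ Sites₀ t A → ∀ p ∈ Sites₀ t A, ‖w p‖ ^ 2 ≤ C * nnForm t A w) → ∀ p : Sites₀ t A, ∃ g : (EuclideanSpace ℝ (Fin 3)), Filter.Tendsto (fun V : Finset (Sites₀ t A) => U V p) Filter.atTop (nhds g) :=
  fun _ _ _ hκ hA hI hPS _ _ _ _ hN hf hU hC hcap p => exists_tendsto_galerkin hA hI hκ hPS hN hf hU hC hcap p

end Summit.AtomisticToContinuum.Crystallization.Theorems.ExcessDecayLiouville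

end
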